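import Summits.BirchSwinnertonDyer.BirchSwinnertonDyer.Theorems.EdixhovenFibreFiveSevenNonEisensteinWitness
import Summits.BirchSwinnertonDyer.BirchSwinnertonDyer.Theorems.AdditiveKolyvaginRoadManinFrameResidueProperRAuxPrimeGroup
import Summits.BirchSwinnertonDyer.BirchSwinnertonDyer.Theorems.AdditiveKolyvaginRoadManinFrameResidueProperRAuxPrimeFrame
import Literature.NumberTheory.GaloisRepresentations.ImaginaryQuadraticCyclotomicProofs
import Literature.NumberTheory.GaloisRepresentations.TateLevelOneWildOdd
import Mathlib.NumberTheory.LegendreSymbol.ZModChar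
import HarnessLib

/-!
# The auxiliary prime of ROAD A′ (Ihara-free L-TWIST), III: the prime, by Chebotarev — PROVED

Cell `pub/bsd-wall`, seat `bsd-wall-manin-p1` (prover, explicit-unit on AKR crux #7
stmt-BirchSwinnertonDyer-20709 `ManinFrameResidueProperR`, line `tame_twist`; serves equally the sibling line
`route-BirchSwinnertonDyer-EdixhovenFibreFiveSeven`, cruxes TDS57 22227 / KP57 23810 / CORNER 23883 / LOW 23884).
THEOREMS ONLY (no definition, no named fact, no `sorry`); route-free. BSD is not proved by this file.

ROAD A′ (MEMO-LTWIST-manin-p1-g6 §3; edix-p2/p3 g3 `LTwistTransfer*`): the transfer cycle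
`z = (Tr^{Nq}_N)^∨ (Tr^{Nq²}_{Nq})^∨ x` gives `Λ(f) ⊆ s·Λ(f ⊗ χ_{q*}) + p·Λ(f)` at every auxiliary prime `q ∤ 2pN`
with `p ∤ (q−1)((q+1)² − a_q²)`, WITHOUT the three-copy Ihara lemma (`diamondRibet1997_iharaLemma_sq`, cite-only);
the KP repair (TORS-TWIST, `TorsTwist.torsTwist`) needs in addition `q* = (−1)^{(q−1)/2} q` a NON-SQUARE mod `p`.
This file PROVES that such a prime exists for every elliptic `E/ℚ` with `E[p]` irreducible, `p ≥ 5`: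

**Theorem** (`exists_prime_auxiliary`, minimal model / `frobeniusTrace`; `exists_prime_auxiliary_lFunction`,
any model / `LFunction`; `auxPrimeWitness`, the packaged shape `∀ V₀ p, 5 ≤ p → Irr V₀ p → ∃ q prime,
q ∤ 2·p·N(V₀) ∧ ¬ IsSquare (q* : ZMod p) ∧ ¬ p ∣ (q−1)((q+1)² − a_q(V₀)²)`). For `W/ℚ` elliptic, `p ≥ 5` prime
with `E[p]` irreducible and any finite set `S` of primes there is a good prime `q ∉ S`, `q ≠ 2, p`, with
`q*` a non-square mod `p`, `q ≢ 1 (mod p)`, `a_q ≢ q + 1` and `a_q ≢ −(q + 1) (mod p)`.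

Proof. In the frame `e` of `E[p]` given by the two eigenvectors of complex conjugation `c₀`
(`RatClosure.exists_eigenvectors`; `exists_frame_of_eigenvectors`) the Galois action is a multiplicative
`ρ : Γ_ℚ →* M₂(𝔽_p)` with `ρ(c₀) = diag(1,−1)`, `det ρ = χ̄_p` (Weil pairing,
`det_eq_modPCyclotomicCharacterZMod_of_exists_weilPairing`) onto `𝔽_pˣ` (`Rat.modNCyclotomicCharacter_surjective`),
no stable line (`Irr`), and the sign `s = χ₄ ∘ χ̄_4 : Γ_ℚ → {±1}` has `s(c₀) = −1`; an element with
`s = 1`, `det` a non-square exists by the surjectivity of `χ̄_{4p}` (CRT; this is `ℚ(i) ≠ ℚ(√−p)`). The group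
theory of the sibling files (`AuxPrime.exists_nonsquare_det_trace_ne`, `…AuxPrimeBorel/…AuxPrimeGroup`) yields
`γ ∈ Γ_ℚ` with `s(γ) det ρ(γ)` a non-square, `det ρ(γ) ≠ 1`, `tr ρ(γ) ≠ ±(1 + det ρ(γ))`; Chebotarev for the open
normal subgroup `ker ρ̄_{E,p} ∩ Gal(ℚ̄/ℚ(μ₄))` (tree `exists_isArithFrobAt_mul_inv_mem_not_mem`, PROVED) gives a
Frobenius `φ` at a good `q ∉ S ∪ {2, p}` with `ρ(φ) = ρ(γ)`, `χ̄_4(φ) = χ̄_4(γ)`; and `χ̄_4(φ) = q`, `χ̄_p(φ) = q`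
(`modNCyclotomicCharacter_eq_residueCard_of_isArithFrobAt`), `tr ρ(φ) = a_q` (Serre (238),
`trace_galoisRepTorsion_frobenius_eq`), `χ₄(q) = (−1)^{(q−1)/2}` (`ZMod.χ₄_eq_neg_one_pow`).

Axioms: `propext`, `Classical.choice`, `Quot.sound`. With edix's transfer closer this removes the cite-only
three-copy Ihara fact from the cone of 20709 / 22227 / 23810 / 23883 / 23884 (F″ remains).

References: [TateGCFT1967] §2.4 (Chebotarev); [Serre1981] §8.1 (238); [SilvermanCSS1997] II §7 (`det ρ̄ = χ`);
[DarmonDiamondTaylor1995] Lemma 4.12 (auxiliary primes of level raising, context).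
-/

set_option autoImplicit false
-- the Theorems directory repeats the summit name (sibling precedent `SignedBaseChangeAssembly.lean`)
set_option linter.dupNamespace false

noncomputable section

open scoped Classical

open WeierstrassCurve NumberField IsDedekindDomain Field
  Literature.NumberTheory.EllipticCurves Literature.NumberTheory.GaloisRepresentations
  Literature.NumberTheory.EllipticCurves.Rank1Residual
  Summit.BirchSwinnertonDyer.BirchSwinnertonDyer.Theorems.NonEisensteinWitness

namespace Summit.BirchSwinnertonDyer.BirchSwinnertonDyer.Theorems.AuxPrime

/-! ### §2 The auxiliary prime -/

/-- **The auxiliary prime of ROAD A′ (minimal model).** For a globally minimal elliptic `W/ℚ`, a prime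
`p ≥ 5` with `E[p]` irreducible and a finite set `S` of primes there is a prime `q ∉ S`, `q ≠ 2`, `q ≠ p`, of
good reduction, with `q* = (−1)^{⌊q/2⌋} q` a non-square mod `p`, `q ≢ 1 (mod p)`, `p ∤ a_q(W) − (q + 1)` and
`p ∤ a_q(W) + (q + 1)`. See the module docstring for the proof (eigenframe of complex conjugation, the group
theory `AuxPrime.exists_nonsquare_det_trace_ne`, Chebotarev in `ℚ(E[p], i)`, Serre's (238)).
[cite: TateGCFT1967, §2.4 (Tchebotarev density theorem)] [cite: Serre1981, §8.1 eq. (238)]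
[cite: SilvermanCSS1997, Ch. II §7 Proposition (det ρ̄ = χ)] -/
theorem exists_prime_auxiliary (W : WeierstrassCurve ℚ) [W.IsElliptic] [W.IsGloballyMinimal]
    (p : ℕ) [Fact p.Prime] (hp5 : 5 ≤ p) (hirr : W.HasIrreducibleModPGaloisRep p)
    (S : Set ℕ) (hS : S.Finite) :
    ∃ (q : ℕ) (_ : Fact q.Prime), q ∉ S ∧ q ≠ 2 ∧ q ≠ p ∧ W.HasGoodReductionAtPrime q ∧
      ¬ IsSquare ((((-1 : ℤ) ^ (q / 2) * q : ℤ)) : ZMod p) ∧ (q : ZMod p) ≠ 1 ∧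
      ¬ (p : ℤ) ∣ W.frobeniusTrace q - (q + 1) ∧ ¬ (p : ℤ) ∣ W.frobeniusTrace q + (q + 1) := by
  have hp : p.Prime := Fact.out
  have hp2 : p ≠ 2 := by omega
  haveI : NeZero p := ⟨hp.ne_zero⟩
  haveI : NeZero (p : ℚ) := NeZero.charZero
  haveI i4 : NeZero (4 : ℕ) := ⟨by norm_num⟩
  haveI : NeZero ((4 : ℕ) : ℚ) := NeZero.charZero
  haveI i4p : NeZero (4 * p) := ⟨mul_ne_zero (by norm_num) hp.ne_zero⟩
  haveI : NeZero ((4 * p : ℕ) : ℚ) := NeZero.charZero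
  -- complex conjugation and its eigenframe
  obtain ⟨c₀, hc₀⟩ := exists_isComplexConjugation (Rat.castHom ℝ)
  obtain ⟨⟨vp, hvp0, hvp⟩, ⟨vm, hvm0, hvm⟩⟩ :=
    RatClosure.exists_eigenvectors W hc₀ (exists_weilPairing_holds W p) hp2
  obtain ⟨e, hep, hem⟩ := exists_frame_of_eigenvectors W p hp2 hvp0 hvp hvm0 hvm
  -- the matrices of the Galois action in the frame `e`, as a multiplicative map
  choose M hM using fun σ ↦ exists_matrix_frame W p e σ
  have hMw : ∀ (σ : absoluteGaloisGroup ℚ) (w : Fin 2 → ZMod p), (M σ).mulVec w = e (σ • e.symm w) :=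
    fun σ w ↦ by rw [hM, e.apply_symm_apply]
  have hext : ∀ A B : Matrix (Fin 2) (Fin 2) (ZMod p), (∀ w, A.mulVec w = B.mulVec w) → A = B := by
    intro A B h
    ext i j
    have := congrFun (h (Pi.single j 1)) i
    rw [Matrix.mulVec_single_one, Matrix.mulVec_single_one] at this
    exact this
  let ρ : absoluteGaloisGroup ℚ →* Matrix (Fin 2) (Fin 2) (ZMod p) :=
    { toFun := M
      map_one' := hext _ _ fun w ↦ by rw [hMw, one_smul, e.apply_symm_apply, Matrix.one_mulVec]
      map_mul' := fun σ τ ↦ hext _ _ fun w ↦ by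
        rw [hMw, mul_smul, ← Matrix.mulVec_mulVec, hMw, hMw, e.symm_apply_apply] }
  have hρ : ∀ σ, ρ σ = M σ := fun _ ↦ rfl
  have hρT : ∀ (σ : absoluteGaloisGroup ℚ) (T : geomTorsion W p), e (σ • T) = (ρ σ).mulVec (e T) :=
    fun σ T ↦ hM σ T
  -- `ρ c₀ = diag(1, -1)`
  have hsymp : e.symm (Pi.single 0 1) = vp := by rw [← hep, e.symm_apply_apply]
  have hsymm : e.symm (Pi.single 1 1) = vm := by rw [← hem, e.symm_apply_apply]
  have hcol0 : (ρ c₀).mulVec (Pi.single 0 1) = Pi.single 0 1 := by rw [hρ, hMw, hsymp, hvp, hep]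
  have hcol1 : (ρ c₀).mulVec (Pi.single 1 1) = -Pi.single 1 1 := by
    rw [hρ, hMw, hsymm, hvm, map_neg, hem]
  rw [Matrix.mulVec_single_one] at hcol0 hcol1
  have hc : ρ c₀ = !![1, 0; 0, -1] := by
    ext i j
    fin_cases i <;> fin_cases j
    · simpa using congrFun hcol0 0
    · simpa using congrFun hcol1 0
    · simpa using congrFun hcol0 1
    · simpa using congrFun hcol1 1
  -- the sign `s = χ₄ ∘ χ̄_4`
  let s : absoluteGaloisGroup ℚ →* (ZMod p)ˣ :=
    (Units.map (Int.castRingHom (ZMod p)).toMonoidHom).comp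
      (ZMod.χ₄.toUnitHom.comp (modNCyclotomicCharacter ℚ 4))
  have hsval : ∀ σ, (s σ : ZMod p) =
      ((ZMod.χ₄ (modNCyclotomicCharacter ℚ 4 σ : ZMod 4) : ℤ) : ZMod p) := fun σ ↦ rfl
  have hs : ∀ σ, s σ = 1 ∨ s σ = -1 := by
    intro σ
    rcases Int.units_eq_one_or (ZMod.χ₄.toUnitHom (modNCyclotomicCharacter ℚ 4 σ)) with h | h
    · left
      change Units.map _ (ZMod.χ₄.toUnitHom (modNCyclotomicCharacter ℚ 4 σ)) = 1
      rw [h, map_one]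
    · right
      change Units.map _ (ZMod.χ₄.toUnitHom (modNCyclotomicCharacter ℚ 4 σ)) = -1
      rw [h]
      ext
      simp
  have hχc : modNCyclotomicCharacter ℚ 4 c₀ = -1 := Units.ext (by
    rw [modNCyclotomicCharacter_of_isComplexConjugation (N := 4) hc₀, Units.val_neg, Units.val_one])
  have hχ₄neg : ZMod.χ₄ (-1 : ZMod 4) = -1 := by decide
  have hsc : s c₀ = -1 := by
    ext
    rw [hsval, hχc, Units.val_neg, Units.val_one, hχ₄neg]
    push_cast
    rfl
  -- `det ρ = χ̄_p`, onto `𝔽_pˣ`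
  have hdet' : ∀ σ, (ρ σ).det = ((modNCyclotomicCharacter ℚ p σ : (ZMod p)ˣ) : ZMod p) := fun σ ↦ by
    rw [← modPCyclotomicCharacterZMod_eq_modNCyclotomicCharacter]
    exact det_eq_modPCyclotomicCharacterZMod_of_exists_weilPairing W p (exists_weilPairing_holds W p) e σ
      _ (hρT σ)
  have hdet : ∀ u : ZMod p, u ≠ 0 → ∃ γ, (ρ γ).det = u := by
    intro u hu
    obtain ⟨γ, hγ⟩ := Rat.modNCyclotomicCharacter_surjective p (Units.mk0 u hu)
    exact ⟨γ, by rw [hdet', hγ, Units.val_mk0]⟩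
  -- an element with `s = 1` and non-square determinant (`ℚ(i) ≠ ℚ(√-p)`): CRT in `(ℤ/4p)ˣ`
  have hω : ∃ γ₀, ¬ IsSquare ((s γ₀ : ZMod p) * (ρ γ₀).det) := by
    have hchar : ringChar (ZMod p) ≠ 2 := by rw [ZMod.ringChar_zmod_n]; exact hp2
    obtain ⟨n₀, hn₀⟩ := quadraticChar_exists_neg_one hchar
    have hn₀' : ¬ IsSquare n₀ := (quadraticChar_neg_one_iff_not_isSquare).mp hn₀
    have hn₀0 : n₀ ≠ 0 := by
      rintro rfl
      exact hn₀' ⟨0, (mul_zero 0).symm⟩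
    have h2p : Nat.Coprime 2 p := Nat.coprime_two_left.mpr (hp.odd_of_ne_two hp2)
    have hcop : Nat.Coprime 4 p := by
      have h := h2p.pow_left 2
      norm_num at h
      exact h
    obtain ⟨k, hk4, hkp⟩ := Nat.chineseRemainder hcop 1 n₀.val
    have hk4' : Nat.Coprime k 4 := by rw [Nat.Coprime, hk4.gcd_eq, Nat.gcd_one_left]
    have hkp' : Nat.Coprime k p := by
      rw [Nat.Coprime, hkp.gcd_eq]
      exact ZMod.val_coe_unit_coprime (Units.mk0 n₀ hn₀0)
    have hk : Nat.Coprime k (4 * p) := Nat.Coprime.mul_right hk4' hkp'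
    obtain ⟨γ₀, hγ₀⟩ := Rat.modNCyclotomicCharacter_surjective (4 * p) (ZMod.unitOfCoprime k hk)
    have h4d : 4 ∣ 4 * p := Dvd.intro p rfl
    have hpd : p ∣ 4 * p := Dvd.intro_left 4 rfl
    have h4 : (modNCyclotomicCharacter ℚ 4 γ₀ : ZMod 4) = 1 := by
      rw [← unitsMap_modNCyclotomicCharacter_of_dvd ℚ h4d, hγ₀, ZMod.unitsMap_def, Units.coe_map,
        ZMod.coe_unitOfCoprime, MonoidHom.coe_coe, ZMod.castHom_apply, ZMod.cast_natCast h4d]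
      have : ((k : ℕ) : ZMod 4) = ((1 : ℕ) : ZMod 4) := (ZMod.natCast_eq_natCast_iff _ _ _).mpr hk4
      rw [this, Nat.cast_one]
    have hp' : (modNCyclotomicCharacter ℚ p γ₀ : ZMod p) = n₀ := by
      rw [← unitsMap_modNCyclotomicCharacter_of_dvd ℚ hpd, hγ₀, ZMod.unitsMap_def, Units.coe_map,
        ZMod.coe_unitOfCoprime, MonoidHom.coe_coe, ZMod.castHom_apply, ZMod.cast_natCast hpd]
      have : ((k : ℕ) : ZMod p) = ((n₀.val : ℕ) : ZMod p) :=
        (ZMod.natCast_eq_natCast_iff _ _ _).mpr hkp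
      rw [this, ZMod.natCast_zmod_val]
    refine ⟨γ₀, ?_⟩
    rw [hsval, h4, hdet', hp', map_one, Int.cast_one, one_mul]
    exact hn₀'
  -- no stable line
  have hirr' : ∀ v : Fin 2 → ZMod p, v ≠ 0 → ∃ γ, ∀ a : ZMod p, (ρ γ).mulVec v ≠ a • v :=
    fun v hv ↦ exists_mulVec_ne_smul W p hirr e M hM v hv
  -- the group theory
  obtain ⟨γ, hnsq, hd1, ht1, ht2⟩ := exists_nonsquare_det_trace_ne hp5 ρ s hs hc hsc hirr' hdet hω
  -- Chebotarev for `ker ρ̄ ∩ Gal(ℚ̄/ℚ(μ₄))`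
  set N : Subgroup (absoluteGaloisGroup ℚ) := (W.galoisRepTorsion p).ker ⊓ rootsOfUnityFixer ℚ 4
    with hNdef
  have hHn : (rootsOfUnityFixer ℚ 4).Normal := by
    rw [rootsOfUnityFixer_eq_ker]
    exact MonoidHom.normal_ker _
  haveI : N.Normal := Subgroup.normal_inf_normal _ _
  have hNopen : IsOpen (N : Set (absoluteGaloisGroup ℚ)) := by
    rw [hNdef, Subgroup.coe_inf]
    exact (W.isOpen_ker_galoisRepTorsion_holds (n := (p : ℤ)) (by exact_mod_cast hp.ne_zero)).inter
      (isOpen_rootsOfUnityFixer ℚ 4)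
  have hΔ0 : minimalDiscriminantInt W ≠ 0 := minimalDiscriminantInt_ne_zero W
  set T : Set ℕ := S ∪ {ℓ | ℓ = p ∨ ℓ = 2 ∨ (ℓ : ℤ) ∣ minimalDiscriminantInt W} with hTdef
  have hT : T.Finite := by
    refine hS.union ((Set.finite_le_nat (max p (max 2 (minimalDiscriminantInt W).natAbs))).subset ?_)
    rintro ℓ (rfl | rfl | hℓ)
    · exact Set.mem_setOf.mpr (le_max_left _ _)
    · exact Set.mem_setOf.mpr (le_max_of_le_right (le_max_left _ _))
    · exact Set.mem_setOf.mpr (le_max_of_le_right (le_max_of_le_right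
        (Nat.le_of_dvd (Int.natAbs_pos.mpr hΔ0) (Int.natCast_dvd.mp hℓ))))
  obtain ⟨v, hvB, -, 𝔓, h𝔓, φ, hφ, hφγ⟩ :=
    exists_isArithFrobAt_mul_inv_mem_not_mem ℚ N hNopen γ _ (finite_setOf_place_over T hT)
  obtain ⟨q, hq, hqv⟩ := exists_prime_natCast_mem v
  have hqT : q ∉ T := fun hmem ↦ hvB (Set.mem_biUnion (x := q) ⟨hmem, hq.ne_zero⟩ hqv)
  have hqS : q ∉ S := fun h ↦ hqT (Or.inl h)
  have hqp : q ≠ p := fun h ↦ hqT (Or.inr (Or.inl h))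
  have hq2 : q ≠ 2 := fun h ↦ hqT (Or.inr (Or.inr (Or.inl h)))
  have hqΔ : ¬ (q : ℤ) ∣ minimalDiscriminantInt W := fun h ↦ hqT (Or.inr (Or.inr (Or.inr h)))
  haveI : Fact q.Prime := ⟨hq⟩
  have hgood : W.HasGoodReductionAtPrime q := hasGoodReductionAtPrime_of_not_dvd W q hqΔ
  -- `φ` acts on `E[p]` as `γ`, and `χ̄_4(φ) = χ̄_4(γ)`
  have hφN : φ * γ⁻¹ ∈ (W.galoisRepTorsion p).ker ∧ φ * γ⁻¹ ∈ rootsOfUnityFixer ℚ 4 := by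
    have h := hφγ
    rw [hNdef, Subgroup.mem_inf] at h
    exact h
  have hφE : ∀ P : geomTorsion W p, φ • P = γ • P := by
    intro P
    have h := (mem_ker_galoisRepTorsion_iff W p _).mp hφN.1 (γ • P)
    rwa [mul_smul, inv_smul_smul] at h
  have hρφ : ρ φ = ρ γ := hext _ _ fun w ↦ by rw [hρ, hρ, hMw, hMw, hφE]
  have hχ4φ : modNCyclotomicCharacter ℚ 4 φ = modNCyclotomicCharacter ℚ 4 γ := by
    have h := hφN.2
    rw [rootsOfUnityFixer_eq_ker, MonoidHom.mem_ker, map_mul, map_inv, mul_inv_eq_one] at h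
    exact h
  have hsφ : s φ = s γ := by
    change Units.map _ (ZMod.χ₄.toUnitHom (modNCyclotomicCharacter ℚ 4 φ)) =
      Units.map _ (ZMod.χ₄.toUnitHom (modNCyclotomicCharacter ℚ 4 γ))
    rw [hχ4φ]
  -- Frobenius values: `χ̄_4(φ) = q`, `χ̄_p(φ) = q`, `tr ρ(φ) = a_q`
  have hqv' : ((Rat.HeightOneSpectrum.primesEquiv v : Nat.Primes) : ℕ) = q :=
    primesEquiv_eq_of_natCast_mem hq hqv
  have hres : v.residueCard = q := by
    rw [Rat.residueCard_eq_natGenerator']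
    exact hqv'
  have h4v : ((4 : ℕ) : 𝓞 ℚ) ∉ v.asIdeal := by
    refine Rat.natCast_not_mem_asIdeal_of_not_dvd ?_
    rw [hqv']
    intro h
    have h' : q ∣ 2 ^ 2 := by norm_num; exact h
    exact hq2 ((Nat.prime_dvd_prime_iff_eq hq Nat.prime_two).mp (hq.dvd_of_dvd_pow h'))
  have h4𝔓 : ((4 : ℕ) : absIntegers (𝓞 ℚ) ℚ) ∉ 𝔓 := natCast_not_mem_of_mem_primesAbove ℚ h4v h𝔓
  have hχ4 : (modNCyclotomicCharacter ℚ 4 φ : ZMod 4) = (q : ZMod 4) := by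
    rw [modNCyclotomicCharacter_eq_residueCard_of_isArithFrobAt h𝔓 h4𝔓 hφ, hres]
  have hpv : ((p : ℕ) : 𝓞 ℚ) ∉ v.asIdeal := by
    refine Rat.natCast_not_mem_asIdeal_of_not_dvd ?_
    rw [hqv']
    intro h
    exact hqp ((Nat.prime_dvd_prime_iff_eq hq hp).mp h)
  have hp𝔓 : ((p : ℕ) : absIntegers (𝓞 ℚ) ℚ) ∉ 𝔓 := natCast_not_mem_of_mem_primesAbove ℚ hpv h𝔓
  have hχp : (modNCyclotomicCharacter ℚ p φ : ZMod p) = (q : ZMod p) := by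
    rw [modNCyclotomicCharacter_eq_residueCard_of_isArithFrobAt h𝔓 hp𝔓 hφ, hres]
  have htr : (ρ φ).trace = (W.frobeniusTrace q : ZMod p) := by
    have h1 := trace_frame_eq W p e φ (ρ φ) (hρT φ)
    have h2 := W.trace_galoisRepTorsion_frobenius_eq p hqp hgood hqv' h𝔓 hφ
    rw [h1] at h2
    exact h2
  -- conclusions
  refine ⟨q, ⟨hq⟩, hqS, hq2, hqp, hgood, ?_, ?_, ?_, ?_⟩
  · have hsdet : (s γ : ZMod p) * (ρ γ).det = ((((-1 : ℤ) ^ (q / 2) * q : ℤ)) : ZMod p) := by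
      rw [← hsφ, ← hρφ, hsval, hχ4, hdet', hχp,
        ZMod.χ₄_eq_neg_one_pow (Nat.odd_iff.mp (hq.odd_of_ne_two hq2))]
      push_cast
      ring
    rw [← hsdet]
    exact hnsq
  · intro h1
    apply hd1
    rw [← hρφ, hdet', hχp, h1]
  · intro hdvd
    apply ht1
    rw [← hρφ, htr, hdet', hχp]
    have h0 : ((W.frobeniusTrace q - (q + 1) : ℤ) : ZMod p) = 0 :=
      (ZMod.intCast_zmod_eq_zero_iff_dvd _ p).mpr hdvd
    push_cast at h0
    linear_combination h0
  · intro hdvd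
    apply ht2
    rw [← hρφ, htr, hdet', hχp]
    have h0 : ((W.frobeniusTrace q + (q + 1) : ℤ) : ZMod p) = 0 :=
      (ZMod.intCast_zmod_eq_zero_iff_dvd _ p).mpr hdvd
    push_cast at h0
    linear_combination h0

/-! ### §3 Any model (`a_q = W.LFunction q`) and the packaged witness -/

/-- **The auxiliary prime of ROAD A′ (any model).** For ANY Weierstrass model `W` of `E/ℚ` with `E[p]`
irreducible, `p ≥ 5`, and any finite `S`: a prime `q ∉ S`, `q ≠ 2`, `q ≠ p`, `q ∤ N_E`, with `q*` a
non-square mod `p`, `q ≢ 1 (mod p)`, `p ∤ a_q(E) ∓ (q + 1)` for `a_q(E) = W.LFunction q` (transport to a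
global minimal model as in `NonEisensteinWitness.exists_prime_modEq_one_not_dvd_lFunction_sub`).
[cite: TateGCFT1967, §2.4 (Tchebotarev density theorem)] -/
theorem exists_prime_auxiliary_lFunction (W : WeierstrassCurve ℚ) [W.IsElliptic] (p : ℕ)
    [Fact p.Prime] (hp5 : 5 ≤ p) (hirr : W.HasIrreducibleModPGaloisRep p) (S : Set ℕ)
    (hS : S.Finite) :
    ∃ q : ℕ, q.Prime ∧ q ∉ S ∧ q ≠ 2 ∧ q ≠ p ∧ ¬ q ∣ W.conductorNorm ℤ ∧
      ¬ IsSquare ((((-1 : ℤ) ^ (q / 2) * q : ℤ)) : ZMod p) ∧ (q : ZMod p) ≠ 1 ∧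
      ¬ (p : ℤ) ∣ W.LFunction q - (q + 1) ∧ ¬ (p : ℤ) ∣ W.LFunction q + (q + 1) := by
  obtain ⟨C, hC⟩ := hasGlobalMinimalModel_rat_holds W
  haveI := hC
  have hirr₀ : (C • W).HasIrreducibleModPGaloisRep p :=
    (Mazur1978.hasIrreducibleModPGaloisRep_smul_iff W C p).mpr hirr
  obtain ⟨q, hqF, hqS, hq2, hqp, hgood, hnsq, hq1, h1, h2⟩ :=
    exists_prime_auxiliary (C • W) p hp5 hirr₀ S hS
  haveI := hqF
  refine ⟨q, hqF.out, hqS, hq2, hqp, ?_, hnsq, hq1, ?_, ?_⟩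
  · rw [← conductorNorm_smul ℤ W C]
    exact not_dvd_conductorNorm_of_hasGoodReductionAtPrime (C • W) hgood
  · rwa [← LFunction_smul W C, LFunction_apply_prime_eq_frobeniusTrace (C • W) q hgood]
  · rwa [← LFunction_smul W C, LFunction_apply_prime_eq_frobeniusTrace (C • W) q hgood]

/-- Elementary repackaging: `q ≢ 1`, `a ≢ q + 1`, `a ≢ −(q + 1) (mod p)` ⟹ `p ∤ (q − 1)((q + 1)² − a²)`.
[folklore] -/
theorem not_dvd_mul_sq_sub_sq {p q : ℕ} (hp : p.Prime) {a : ℤ} (hq1 : (q : ZMod p) ≠ 1)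
    (h1 : ¬ (p : ℤ) ∣ a - (q + 1)) (h2 : ¬ (p : ℤ) ∣ a + (q + 1)) :
    ¬ (p : ℤ) ∣ ((q : ℤ) - 1) * (((q : ℤ) + 1) ^ 2 - a ^ 2) := by
  have hpZ : Prime (p : ℤ) := Nat.prime_iff_prime_int.mp hp
  haveI : NeZero p := ⟨hp.ne_zero⟩
  intro h
  rcases hpZ.dvd_or_dvd h with h' | h'
  · apply hq1
    have h0 : (((q : ℤ) - 1 : ℤ) : ZMod p) = 0 := (ZMod.intCast_zmod_eq_zero_iff_dvd _ p).mpr h'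
    push_cast at h0
    linear_combination h0
  · have hfac : ((q : ℤ) + 1) ^ 2 - a ^ 2 = -((a - (q + 1)) * (a + (q + 1))) := by ring
    rw [hfac, dvd_neg] at h'
    rcases hpZ.dvd_or_dvd h' with h'' | h''
    · exact h1 h''
    · exact h2 h''

/-- **ROAD A′ witness for all `p ≥ 5` (any model).** For every elliptic `V₀/ℚ` and prime `p ≥ 5` with `Irr V₀ p`
there is a prime `q ≠ 2, p`, `q ∤ N(V₀)`, with `q* = (−1)^{⌊q/2⌋} q` a non-square mod `p` and
`p ∤ (q − 1)((q + 1)² − a_q(V₀)²)` (`a_q(V₀) = V₀.LFunction q`); the shape of the transfer witness `hW″` of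
`LTwistTransfer.maninFrameResidueProperR_of_kato_of_transferWitness` (edix-p3, p594464) without its restrictions
`p ∈ {5,7}`, `Addv`, global minimality. [cite: TateGCFT1967, §2.4 (Tchebotarev density theorem)] -/
theorem auxPrimeWitness :
    ∀ (V₀ : WeierstrassCurve ℚ) [V₀.IsElliptic] (p : ℕ) [Fact p.Prime], 5 ≤ p → Irr V₀ p →
      ∃ q : ℕ, q.Prime ∧ q ≠ 2 ∧ q ≠ p ∧ ¬ q ∣ V₀.conductorNorm ℤ ∧
        ¬ IsSquare ((((-1 : ℤ) ^ (q / 2) * q : ℤ)) : ZMod p) ∧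
        ¬ (p : ℤ) ∣ ((q : ℤ) - 1) * (((q : ℤ) + 1) ^ 2 - V₀.LFunction q ^ 2) := by
  intro V₀ _ p _ hp5 hirr
  obtain ⟨q, hq, -, hq2, hqp, hqN, hnsq, hq1, h1, h2⟩ :=
    exists_prime_auxiliary_lFunction V₀ p hp5 hirr ∅ Set.finite_empty
  exact ⟨q, hq, hq2, hqp, hqN, hnsq, not_dvd_mul_sq_sub_sq (Fact.out : p.Prime) hq1 h1 h2⟩

/-- **The TRANSFER WITNESS `hW″` of ROAD A′, DISCHARGED** — VERBATIM the hypothesis `hW` of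
`LTwistTransfer.maninFrameResidueProperR_of_kato_of_transferWitness` /
`…twistDegreeStepFiveSeven_of_kato_of_transferWitness` / `…kpResidueManinUnitFiveSeven_of_kato_of_transferWitness`
(edix-p3 g3, p594464) and of `TeichmullerTwistDescent.not_dvd_c_of_kato_of_transferWitness` (edix-p2 g3): for
`p ∈ {5,7}` and every globally minimal elliptic `V₀/ℚ`, additive at `p` (not used) with `E[p]` irreducible, there
is a prime `q ≠ 2, p`, `q ∤ N(V₀)`, with `q*` a non-square mod `p` and `p ∤ (q − 1)((q + 1)² − a_q(V₀)²)`.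
Consequently AKR crux #7 (20709), TDS57 (22227), KP57 (23810), CORNER/LOW/PSMU/SCMU57 rest on F″ ALONE — no Ihara
lemma, no cite-only Chebotarev. [cite: TateGCFT1967, §2.4 (Tchebotarev density theorem)]
[cite: DarmonDiamondTaylor1995, Lemma 4.12 (auxiliary primes; context)] -/
theorem transferWitness :
    ∀ (p : ℕ) [Fact p.Prime] (V₀ : WeierstrassCurve ℚ) [V₀.IsElliptic] [V₀.IsGloballyMinimal],
      (p = 5 ∨ p = 7) → Addv V₀ p → Irr V₀ p →
      ∃ q : ℕ, q.Prime ∧ q ≠ 2 ∧ q ≠ p ∧ ¬ q ∣ V₀.conductorNorm ℤ ∧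
        ¬ IsSquare ((((-1 : ℤ) ^ (q / 2) * q : ℤ)) : ZMod p) ∧
        ¬ (p : ℤ) ∣ ((q : ℤ) - 1) * (((q : ℤ) + 1) ^ 2 - V₀.LFunction q ^ 2) := by
  intro p _ V₀ _ _ hp57 _ hirr
  have hp5 : 5 ≤ p := by
    rcases hp57 with h | h <;> omega
  exact auxPrimeWitness V₀ p hp5 hirr

end Summit.BirchSwinnertonDyer.BirchSwinnertonDyer.Theorems.AuxPrime

end
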